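import Literature.Analysis.Fourier.FractalUncertaintyPrincipleProofs
import HarnessLib

/-!
# The small cover property of `δ`-regular sets (Bourgain–Dyatlov 2018, Lemma 2.8)

Topic `Literature/Analysis/Fourier`. J. Bourgain, S. Dyatlov, *Spectral gaps without the pressure
condition*, Ann. of Math. 187 (2018), §2.2, Lemma "The small cover property": if `X` is
`δ`-regular with constant `C_R` on scales `α₀` to `α₁` and `I` is an interval, `α₀ ≤ ρ ≤ |I| ≤ α₁`,
then `X ∩ I` is covered by a nonoverlapping collection of `N ≤ 12 C_R² (|I|/ρ)^δ` intervals of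
size `ρ` (here with the better constant `6 C_R²`) — namely the grid intervals `ρ[j, j+1]` meeting `X ∩ I`. Proved here (sorry-free) with the
grid intervals indexed by a `Finset ℤ`, which is the form used to build the adapted weight of BD18
Lemma 3.1; the count is the residue-mod-3 device `card_mul_le_of_centred_intervals`.

* `IsRegularSet.exists_grid_cover` — the lemma.
-/

namespace Literature.Analysis.Fourier

open _root_.MeasureTheory Set

/-- **The small cover property** (BD18 Lemma 2.8, grid form): for `X` `δ`-regular with constant
`C_R ≥ 1` on scales `α₀` to `α₁`, an interval `[a, a + ℓ]` and `0 < ρ` with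
`α₀ ≤ ρ ≤ ℓ ≤ α₁`, the grid intervals `[jρ, (j+1)ρ]` meeting `X ∩ [a, a+ℓ]` form a finite family
`S` with `#S ≤ 6 C_R² (ℓ/ρ)^δ` covering `X ∩ [a, a+ℓ]` (the paper prints `12 C_R²`; the centred
intervals of the count lie in `[a - ρ/2, a + ℓ + ρ/2]`, of mass `≤ 2 C_R ℓ^δ`).
[cite: BourgainDyatlov2018, Lemma 2.8] -/
theorem IsRegularSet.exists_grid_cover {X : Set ℝ} {δ C_R α₀ α₁ : ℝ}
    (hX : IsRegularSet X δ C_R α₀ α₁) (hC : 1 ≤ C_R) {a ℓ ρ : ℝ} (hρ : 0 < ρ)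
    (h₀ : α₀ ≤ ρ) (hρℓ : ρ ≤ ℓ) (h₁ : ℓ ≤ α₁) :
    ∃ S : Finset ℤ, (∀ j ∈ S, (X ∩ Icc a (a + ℓ) ∩ Icc ((j : ℝ) * ρ) (((j : ℝ) + 1) * ρ)).Nonempty) ∧
      (X ∩ Icc a (a + ℓ) ⊆ ⋃ j ∈ S, Icc ((j : ℝ) * ρ) (((j : ℝ) + 1) * ρ)) ∧
      ((S.card : ℝ) ≤ 6 * C_R ^ 2 * (ℓ / ρ) ^ δ) := by
  classical
  obtain ⟨-, -, μ, -, hreg⟩ := hX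
  have hℓ : 0 < ℓ := hρ.trans_le hρℓ
  -- the candidate grid indices
  set K₁ : ℤ := ⌊a / ρ⌋ with hK₁
  set K₂ : ℤ := ⌊(a + ℓ) / ρ⌋ with hK₂
  set S : Finset ℤ := (Finset.Icc K₁ K₂).filter fun j =>
    (X ∩ Icc a (a + ℓ) ∩ Icc ((j : ℝ) * ρ) (((j : ℝ) + 1) * ρ)).Nonempty with hS
  refine ⟨S, fun j hj => (Finset.mem_filter.1 hj).2, ?_, ?_⟩
  · -- covering
    intro x hx
    set j : ℤ := ⌊x / ρ⌋ with hj
    have hj1 : (j : ℝ) ≤ x / ρ := Int.floor_le _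
    have hj2 : x / ρ < (j : ℝ) + 1 := Int.lt_floor_add_one _
    rw [le_div_iff₀ hρ] at hj1
    rw [div_lt_iff₀ hρ] at hj2
    have hxc : x ∈ Icc ((j : ℝ) * ρ) (((j : ℝ) + 1) * ρ) := ⟨hj1, hj2.le⟩
    have hjS : j ∈ S := by
      rw [hS, Finset.mem_filter, Finset.mem_Icc]
      refine ⟨⟨?_, ?_⟩, ⟨x, hx, hxc⟩⟩
      · exact Int.floor_le_floor (by gcongr; exact hx.2.1)
      · exact Int.floor_le_floor (by gcongr; exact hx.2.2)
    exact Set.mem_iUnion₂.2 ⟨j, hjS, hxc⟩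
  · -- counting, via centred intervals of mass `≥ C_R⁻¹ ρ^δ` inside `[a - 2ρ, a + ℓ + 2ρ]`
    have hpt : ∀ j ∈ S, ∃ c : ℝ, c ∈ X ∧ c ∈ Icc a (a + ℓ) ∧
        (0 : ℝ) + j * ρ ≤ c ∧ c ≤ 0 + (j + 1) * ρ := by
      intro j hj
      obtain ⟨c, ⟨hcX, hcI⟩, hcJ⟩ := (Finset.mem_filter.1 hj).2
      exact ⟨c, hcX, hcI, by simpa using hcJ.1, by simpa using hcJ.2⟩
    choose! c hcX hcI hc1 hc2 using hpt
    set E : Set ℝ := Icc (a - ρ / 2) (a + ℓ + ρ / 2) with hE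
    have hm : ∀ j ∈ S, ENNReal.ofReal (C_R⁻¹ * ρ ^ δ) ≤ μ (Icc (c j - ρ / 2) (c j + ρ / 2)) := by
      intro j hj
      have := (hreg (c j - ρ / 2) (c j + ρ / 2) (by linarith) (by linarith) (by linarith)).2 (by
        have : (c j - ρ / 2 + (c j + ρ / 2)) / 2 = c j := by ring
        rw [this]; exact hcX j hj)
      rwa [show c j + ρ / 2 - (c j - ρ / 2) = ρ by ring] at this
    have hEsub : ∀ j ∈ S, Icc (c j - ρ / 2) (c j + ρ / 2) ⊆ E := by
      intro j hj
      have := hcI j hj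
      apply Icc_subset_Icc <;> linarith [this.1, this.2]
    -- `μ(E) ≤ 2 C_R ℓ^δ`: cover `E` by two intervals of size `ℓ`
    have hIℓ : ∀ s : ℝ, μ (Icc s (s + ℓ)) ≤ ENNReal.ofReal (C_R * ℓ ^ δ) := by
      intro s
      have := (hreg s (s + ℓ) (by linarith) (by linarith) (by linarith)).1
      rwa [show s + ℓ - s = ℓ by ring] at this
    have hEcov : E ⊆ Icc (a - ρ / 2) (a - ρ / 2 + ℓ) ∪ Icc (a + ρ / 2) (a + ρ / 2 + ℓ) := by
      intro y hy
      simp only [hE, mem_Icc, mem_union] at hy ⊢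
      by_cases h1 : y ≤ a - ρ / 2 + ℓ
      · exact Or.inl ⟨hy.1, h1⟩
      · exact Or.inr ⟨by linarith, by linarith⟩
    have hnn : 0 ≤ C_R * ℓ ^ δ := by positivity
    have hμE : μ E ≤ ENNReal.ofReal (2 * C_R * ℓ ^ δ) := by
      calc μ E ≤ μ (Icc (a - ρ / 2) (a - ρ / 2 + ℓ) ∪ Icc (a + ρ / 2) (a + ρ / 2 + ℓ)) :=
            measure_mono hEcov
        _ ≤ μ (Icc (a - ρ / 2) (a - ρ / 2 + ℓ)) + μ (Icc (a + ρ / 2) (a + ρ / 2 + ℓ)) :=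
            measure_union_le _ _
        _ ≤ ENNReal.ofReal (C_R * ℓ ^ δ) + ENNReal.ofReal (C_R * ℓ ^ δ) :=
            add_le_add (hIℓ _) (hIℓ _)
        _ = ENNReal.ofReal (2 * C_R * ℓ ^ δ) := by
            rw [← ENNReal.ofReal_add hnn hnn]
            congr 1; ring
    have hcount := card_mul_le_of_centred_intervals (μ := μ) (S := S) (c := c) (p := 0) hρ
      (by positivity : (0 : ℝ) ≤ 2 * C_R * ℓ ^ δ) (fun j hj => ⟨hc1 j hj, hc2 j hj⟩) hm hEsub hμE
    -- `#S · C_R⁻¹ ρ^δ ≤ 6 C_R ℓ^δ`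
    have hρδ : 0 < ρ ^ δ := Real.rpow_pos_of_pos hρ δ
    have hC0 : 0 < C_R := by linarith
    rw [Real.div_rpow hℓ.le hρ.le, mul_div_assoc', le_div_iff₀ hρδ]
    have : (S.card : ℝ) * ρ ^ δ = C_R * ((S.card : ℝ) * (C_R⁻¹ * ρ ^ δ)) := by field_simp
    rw [this]
    calc C_R * ((S.card : ℝ) * (C_R⁻¹ * ρ ^ δ)) ≤ C_R * (3 * (2 * C_R * ℓ ^ δ)) :=
          mul_le_mul_of_nonneg_left hcount hC0.le
      _ = 6 * C_R ^ 2 * ℓ ^ δ := by ring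

end Literature.Analysis.Fourier
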